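import Mathlib.NumberTheory.LegendreSymbol.Basic
import Mathlib.NumberTheory.LegendreSymbol.QuadraticChar.Basic
import Mathlib.Algebra.Polynomial.BigOperators
import Mathlib.Algebra.Polynomial.Degree.Lemmas
import Mathlib.Algebra.Polynomial.Eval.Defs
import Mathlib.Data.Complex.Basic
import Mathlib.Algebra.Polynomial.AlgebraMap
import Mathlib.Algebra.Polynomial.Reverse
import HarnessLib

/-!
# Fekete polynomials

For a prime `p`, the **Fekete polynomial** is

  `f_p(t) := Σ_{a=0}^{p-1} (a/p) t^a ∈ ℤ[t]`,

`(a/p)` the Legendre symbol (B. Conrey, A. Granville, B. Poonen, K. Soundararajan, *Zeros of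
Fekete polynomials*, Ann. Inst. Fourier 50 (2000) 865–889 [ConreyEtAl2000], (1.2); named after
Fekete's observation, reported by Pólya 1919, that the absence of zeros of `f_p` in `(0, 1)` would
exclude Siegel zeros of `L(s, (·/p))`, loc. cit. (1.1)–(1.2)). We define it over `ℤ` with
Mathlib's `legendreSym`:

* `feketePolynomial p = ∑ m ∈ Finset.range p, C (legendreSym p m) * X ^ m`

— the body requested by route `ValiantsHypothesis/FeketeSOS`, whose items inline the complex
polynomial `∑ m ∈ Finset.range p, C ((legendreSym p m : ℤ) : ℂ) * X ^ m`; `map_feketePolynomial_complex`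
identifies the two LITERALLY, so later items may write `(feketePolynomial p).map (Int.castRingHom ℂ)`.

## API (all proved)
* `coeff_feketePolynomial` (`= (n/p)` for `n < p`, `0` beyond), `coeff_feketePolynomial_zero`,
  `X_dvd_feketePolynomial`;
* `support_feketePolynomial = Finset.Ico 1 p` (the Legendre symbol vanishes exactly at `p ∣ n`),
  `card_support_feketePolynomial = p − 1`, `feketePolynomial_ne_zero`,
  `natDegree_feketePolynomial = p − 1`;
* `sum_range_legendreSym` (`Σ_{a<p} (a/p) = 0` for odd `p`, from Mathlib's `quadraticChar_sum_zero`)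
  and `eval_one_feketePolynomial` (`f_p(1) = 0`, loc. cit. §2, "whereas in contrast `f_p(1) = 0`";
  false for `p = 2`, where `f_2 = t`);
* `map_feketePolynomial` (any ring), `map_feketePolynomial_complex` (the route's inline form).
* (appended 2026-08-15) `coeff_feketePolynomial_of_le`, `degree_feketePolynomial`,
  `leadingCoeff_feketePolynomial` (`= (−1/p)`); the reciprocal symmetry of loc. cit. §1,
  `t^p f_p(1/t) = (−1/p) f_p(t)`, as `coeff_feketePolynomial_rev` (`coeff (p − n) = (−1/p) · coeff n`)
  and `reflect_feketePolynomial` (`reflect p f_p = C (−1/p) * f_p`), with the consequence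
  `eval_neg_one_feketePolynomial` (`f_p(−1) = 0` for `p ≡ 1 (mod 4)`); the evaluation forms
  `eval_feketePolynomial`, `aeval_feketePolynomial` (`f_p(z) = Σ_{m<p} (m/p) z^m` in any commutative
  ring) and `eval_map_feketePolynomial_complex` (`z ∈ ℂ`, the setting of loc. cit. Thm 1 / Prop. 1).

## Not here
The analytic results of [ConreyEtAl2000] (Thm 1: asymptotically `κ₀ p` zeros on `|z| = 1`,
`0.500668 < κ₀ < 0.500813`; Prop. 1: all zeros in `1/2 < |t| < 2` off the origin); Fekete
polynomials of general Dirichlet characters. (The reciprocal symmetry `t^p f_p(1/t) = (−1/p) f_p(t)`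
of §1 IS here since 2026-08-15: `reflect_feketePolynomial`.) Mathlib has no Fekete polynomial (searched `Fekete`, `fekete`: only the tree's
Fekete–Pólya positivity barrier files, which work with `L`-series, not with `f_p`).
-/

noncomputable section

open Polynomial Finset

namespace Literature.NumberTheory.LFunctions

variable (p : ℕ) [Fact p.Prime]

/-- The **Fekete polynomial** `f_p(t) = Σ_{a=0}^{p-1} (a/p) t^a ∈ ℤ[t]` of the prime `p`,
`(a/p) = legendreSym p a` the Legendre symbol. [cite: ConreyEtAl2000, (1.2)] -/
def feketePolynomial : Polynomial ℤ :=
  ∑ m ∈ Finset.range p, Polynomial.C (legendreSym p m) * Polynomial.X ^ m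

/-- Unfolding of `feketePolynomial` (`rfl`). [cite: ConreyEtAl2000, (1.2)] -/
theorem feketePolynomial_def :
    feketePolynomial p = ∑ m ∈ Finset.range p, Polynomial.C (legendreSym p m) * Polynomial.X ^ m :=
  rfl

/-! ### Coefficients, support, degree -/

/-- **Coefficients**: the coefficient of `t^n` in `f_p` is `(n/p)` for `n < p` and `0` for `n ≥ p`.
[cite: ConreyEtAl2000, (1.2)] -/
theorem coeff_feketePolynomial (n : ℕ) :
    (feketePolynomial p).coeff n = if n < p then legendreSym p n else 0 := by
  simp only [feketePolynomial, finsetSum_coeff, coeff_C_mul, coeff_X_pow, mul_ite, mul_one, mul_zero]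
  split_ifs with h
  · rw [Finset.sum_eq_single_of_mem n (Finset.mem_range.2 h) fun m _ hm => if_neg (Ne.symm hm),
      if_pos rfl]
  · exact Finset.sum_eq_zero fun m hm => if_neg (by rintro rfl; exact h (Finset.mem_range.1 hm))

/-- The coefficient of `t^n`, `n < p`, is the Legendre symbol `(n/p)`. [cite: ConreyEtAl2000, (1.2)] -/
theorem coeff_feketePolynomial_of_lt {n : ℕ} (hn : n < p) :
    (feketePolynomial p).coeff n = legendreSym p n := by
  rw [coeff_feketePolynomial, if_pos hn]

/-- The constant coefficient vanishes (`(0/p) = 0`). [cite: ConreyEtAl2000, (1.2)] -/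
@[simp] theorem coeff_feketePolynomial_zero : (feketePolynomial p).coeff 0 = 0 := by
  rw [coeff_feketePolynomial_of_lt p (Fact.out : p.Prime).pos, Nat.cast_zero, legendreSym.at_zero]

/-- `t ∣ f_p(t)`. [cite: ConreyEtAl2000, §1 (zeros "other than t = 0")] -/
theorem X_dvd_feketePolynomial : (X : Polynomial ℤ) ∣ feketePolynomial p :=
  X_dvd_iff.2 (coeff_feketePolynomial_zero p)

/-- For `n < p` the Legendre symbol `(n/p)` vanishes iff `n = 0`. [folklore] -/
theorem legendreSym_natCast_eq_zero_iff {n : ℕ} (hn : n < p) : legendreSym p n = 0 ↔ n = 0 := by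
  rw [legendreSym.eq_zero_iff, Int.cast_natCast, ZMod.natCast_eq_zero_iff]
  constructor
  · intro h
    exact Nat.eq_zero_of_dvd_of_lt h hn
  · rintro rfl
    exact dvd_zero p

/-- **Support**: the exponents with non-zero coefficient are exactly `1, …, p − 1`. [cite: ConreyEtAl2000, (1.2)] -/
theorem support_feketePolynomial : (feketePolynomial p).support = Finset.Ico 1 p := by
  ext n
  rw [mem_support_iff, coeff_feketePolynomial, Finset.mem_Ico]
  by_cases hn : n < p
  · rw [if_pos hn, Ne, legendreSym_natCast_eq_zero_iff p hn]
    omega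
  · rw [if_neg hn]
    simp only [ne_eq, not_true_eq_false, false_iff, not_and, not_lt]
    intro _
    exact not_lt.1 hn

/-- `f_p` has exactly `p − 1` monomials. [cite: ConreyEtAl2000, (1.2)] -/
theorem card_support_feketePolynomial : (feketePolynomial p).support.card = p - 1 := by
  rw [support_feketePolynomial, Nat.card_Ico]

/-- `f_p ≠ 0`. [cite: ConreyEtAl2000, (1.2)] -/
theorem feketePolynomial_ne_zero : feketePolynomial p ≠ 0 := by
  intro h
  have hcard := card_support_feketePolynomial p
  rw [h, support_zero, Finset.card_empty] at hcard
  have := (Fact.out : p.Prime).two_le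
  omega

/-- **Degree**: `deg f_p = p − 1` (the top coefficient is `((p−1)/p) = (−1/p) ≠ 0`). [cite: ConreyEtAl2000, (1.2)] -/
theorem natDegree_feketePolynomial : (feketePolynomial p).natDegree = p - 1 := by
  have hp := (Fact.out : p.Prime).two_le
  refine le_antisymm ?_ ?_
  · rw [natDegree_le_iff_coeff_eq_zero]
    intro n hn
    rw [coeff_feketePolynomial, if_neg (by omega)]
  · refine le_natDegree_of_ne_zero ?_
    rw [coeff_feketePolynomial_of_lt p (by omega), Ne, legendreSym_natCast_eq_zero_iff p (by omega)]
    omega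

/-! ### The value at `1` -/

/-- **`Σ_{a=0}^{p-1} (a/p) = 0`** for an odd prime `p` (as many residues as non-residues; Mathlib's
`quadraticChar_sum_zero` transported along `Finset.range p ≃ ZMod p`). [folklore] -/
theorem sum_range_legendreSym (hp : p ≠ 2) : ∑ m ∈ Finset.range p, legendreSym p m = 0 := by
  have h1 : ∑ m ∈ Finset.range p, legendreSym p m = ∑ i : Fin p, legendreSym p (i : ℕ) :=
    (Fin.sum_univ_eq_sum_range (fun m => legendreSym p m) p).symm
  have hbij : Function.Bijective (fun i : Fin p => ((i : ℕ) : ZMod p)) := by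
    rw [Fintype.bijective_iff_injective_and_card, ZMod.card, Fintype.card_fin]
    refine ⟨fun i j h => Fin.ext ?_, rfl⟩
    have h' := congrArg ZMod.val h
    simp only [ZMod.val_natCast, Nat.mod_eq_of_lt i.isLt, Nat.mod_eq_of_lt j.isLt] at h'
    exact h'
  rw [h1, Fintype.sum_bijective _ hbij (fun i => legendreSym p (i : ℕ))
    (fun a => quadraticChar (ZMod p) a) (fun i => by simp [legendreSym])]
  exact quadraticChar_sum_zero (by rwa [ZMod.ringChar_zmod_n])

/-- **`f_p(1) = 0`** for an odd prime `p` ([ConreyEtAl2000, §2]: "whereas in contrast `f_p(1) = 0`").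
For `p = 2`, `f_2(t) = t` and `f_2(1) = 1`. [cite: ConreyEtAl2000, §2] -/
theorem eval_one_feketePolynomial (hp : p ≠ 2) : (feketePolynomial p).eval 1 = 0 := by
  simp only [feketePolynomial, eval_finsetSum, eval_mul, eval_C, eval_pow, eval_X, one_pow, mul_one]
  exact sum_range_legendreSym p hp

/-- `1` is a root of `f_p` for odd `p`. [cite: ConreyEtAl2000, §2] -/
theorem isRoot_one_feketePolynomial (hp : p ≠ 2) : (feketePolynomial p).IsRoot 1 :=
  eval_one_feketePolynomial p hp

/-! ### Change of coefficients -/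

/-- `f_p` over any ring: mapping the coefficients gives `Σ_{m<p} ((m/p) : R) t^m`. [cite: ConreyEtAl2000, (1.2)] -/
theorem map_feketePolynomial {R : Type*} [CommRing R] (f : ℤ →+* R) :
    (feketePolynomial p).map f = ∑ m ∈ Finset.range p, Polynomial.C (f (legendreSym p m)) * Polynomial.X ^ m := by
  simp only [feketePolynomial, Polynomial.map_sum, Polynomial.map_mul, map_C, Polynomial.map_pow, map_X]

/-- **The complex Fekete polynomial** is LITERALLY the polynomial inlined by the items of route
`ValiantsHypothesis/FeketeSOS`: `(feketePolynomial p).map (Int.castRingHom ℂ) =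
∑ m ∈ Finset.range p, C ((legendreSym p m : ℤ) : ℂ) * X ^ m`. [cite: ConreyEtAl2000, (1.2)] -/
theorem map_feketePolynomial_complex :
    (feketePolynomial p).map (Int.castRingHom ℂ) =
      ∑ m ∈ Finset.range p, Polynomial.C ((legendreSym p m : ℤ) : ℂ) * Polynomial.X ^ m :=
  map_feketePolynomial p (Int.castRingHom ℂ)


/-! ### Appended 2026-08-15: degree and leading coefficient, the symmetry `a ↔ p − a`, evaluation forms -/

/-- For `p ≤ n`, the `n`-th coefficient of `f_p` vanishes. [cite: ConreyEtAl2000, (1.2)] -/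
theorem coeff_feketePolynomial_of_le {n : ℕ} (hn : p ≤ n) : (feketePolynomial p).coeff n = 0 := by
  rw [coeff_feketePolynomial, if_neg (not_lt.mpr hn)]

/-- `deg f_p = p − 1`, `degree` form. [cite: ConreyEtAl2000, (1.2)] -/
theorem degree_feketePolynomial : (feketePolynomial p).degree = (p - 1 : ℕ) := by
  rw [degree_eq_natDegree (feketePolynomial_ne_zero p), natDegree_feketePolynomial]

/-- `((p − n)/p) = (−n/p)` for `n ≤ p`. [folklore] -/
theorem legendreSym_natCast_sub {n : ℕ} (hn : n ≤ p) :
    legendreSym p (p - n : ℕ) = legendreSym p (-n) := by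
  rw [legendreSym, legendreSym]
  congr 1
  push_cast [Nat.cast_sub hn, ZMod.natCast_self]
  ring

/-- **The coefficient symmetry of `f_p`** ("combining the `a` and `p − a` terms", loc. cit. §1):
`coeff (p − n) = (−1/p) · coeff n`, i.e. `((p−a)/p) = (−1/p)(a/p)`; both sides vanish unless
`0 < n < p`. [cite: ConreyEtAl2000, §1] -/
theorem coeff_feketePolynomial_rev (n : ℕ) :
    (feketePolynomial p).coeff (p - n) = legendreSym p (-1) * (feketePolynomial p).coeff n := by
  rcases Nat.eq_zero_or_pos n with rfl | hn0
  · rw [Nat.sub_zero, coeff_feketePolynomial_of_le p le_rfl, coeff_feketePolynomial_zero, mul_zero]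
  rcases lt_or_ge n p with hnp | hpn
  · rw [coeff_feketePolynomial_of_lt p (Nat.sub_lt (Fact.out : p.Prime).pos hn0),
      coeff_feketePolynomial_of_lt p hnp, legendreSym_natCast_sub p hnp.le, neg_eq_neg_one_mul,
      legendreSym.mul]
  · rw [Nat.sub_eq_zero_of_le hpn, coeff_feketePolynomial_zero, coeff_feketePolynomial_of_le p hpn,
      mul_zero]

/-- The leading coefficient of `f_p` is `((p−1)/p) = (−1/p)`. [cite: ConreyEtAl2000, (1.2)] -/
theorem leadingCoeff_feketePolynomial :
    (feketePolynomial p).leadingCoeff = legendreSym p (-1) := by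
  rw [leadingCoeff, natDegree_feketePolynomial, coeff_feketePolynomial_rev p 1,
    coeff_feketePolynomial_of_lt p (Fact.out : p.Prime).one_lt, Nat.cast_one, legendreSym.at_one,
    mul_one]

/-- **The reciprocal symmetry** `t^p f_p(1/t) = (−1/p) f_p(t)` (loc. cit. §1, "By (1.2) we have …;
and so the zeros of `f_p(t)`, other than `t = 0`, are symmetric about the unit circle"), stated with
Mathlib's `Polynomial.reflect` (`reflect p f` is `t^p f(1/t)`). [cite: ConreyEtAl2000, §1] -/
theorem reflect_feketePolynomial :
    (feketePolynomial p).reflect p = C (legendreSym p (-1)) * feketePolynomial p := by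
  ext i
  rw [coeff_reflect, coeff_C_mul]
  rcases le_or_gt i p with hi | hi
  · rw [revAt_le hi, coeff_feketePolynomial_rev]
  · rw [revAt_eq_self_of_lt hi, coeff_feketePolynomial_of_le p hi.le, mul_zero]

/-- `f_p(x) = Σ_{m<p} (m/p) x^m` for `x ∈ ℤ`. [cite: ConreyEtAl2000, (1.2)] -/
theorem eval_feketePolynomial (x : ℤ) :
    (feketePolynomial p).eval x = ∑ m ∈ Finset.range p, legendreSym p m * x ^ m := by
  simp only [feketePolynomial, eval_finsetSum, eval_mul, eval_C, eval_pow, eval_X]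

/-- `f_p(z) = Σ_{m<p} (m/p) z^m` in any commutative ring (e.g. `z ∈ ℂ`). [cite: ConreyEtAl2000, (1.2)] -/
theorem aeval_feketePolynomial {A : Type*} [CommRing A] (z : A) :
    aeval z (feketePolynomial p) = ∑ m ∈ Finset.range p, (legendreSym p m : A) * z ^ m := by
  simp only [feketePolynomial, map_sum, map_mul, aeval_C, algebraMap_int_eq, Int.coe_castRingHom,
    map_pow, aeval_X]

/-- The complex Fekete polynomial evaluated at `z ∈ ℂ`: `f_p(z) = Σ_{a<p} (a/p) z^a` (the setting of
loc. cit. Theorem 1 and Proposition 1). [cite: ConreyEtAl2000, (1.2)] -/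
theorem eval_map_feketePolynomial_complex (z : ℂ) :
    ((feketePolynomial p).map (Int.castRingHom ℂ)).eval z
      = ∑ m ∈ Finset.range p, (legendreSym p m : ℂ) * z ^ m := by
  rw [eval_map, ← aeval_feketePolynomial p z, aeval_def, algebraMap_int_eq]

/-- **`f_p(−1) = 0` for `p ≡ 1 (mod 4)`**: by the symmetry `a ↔ p − a`,
`f_p(−1) = (−1/p) (−1)^p f_p(−1) = −f_p(−1)` when `(−1/p) = 1` (loc. cit. Prop. 1 lists `−1` among
the possible exceptional zeros). [folklore] -/
theorem eval_neg_one_feketePolynomial (hp : p % 4 = 1) : (feketePolynomial p).eval (-1) = 0 := by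
  have hp2 : p ≠ 2 := by rintro rfl; norm_num at hp
  have hodd : Odd p := (Fact.out : p.Prime).odd_of_ne_two hp2
  have hneg1 : legendreSym p (-1) = 1 := by
    rw [legendreSym.at_neg_one hp2, ZMod.χ₄_nat_one_mod_four hp]
  -- write `f_p(−1)` as a sum over `0 ≤ i ≤ p` of `coeff i · (−1)^i` and reflect the range
  have hdeg : (feketePolynomial p).natDegree < p + 1 := by
    rw [natDegree_feketePolynomial]; omega
  have hS : (feketePolynomial p).eval (-1)
      = ∑ i ∈ Finset.range (p + 1), (feketePolynomial p).coeff i * (-1) ^ i :=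
    eval_eq_sum_range' hdeg (-1)
  have hrefl : ∑ i ∈ Finset.range (p + 1), (feketePolynomial p).coeff i * (-1) ^ i
      = ∑ i ∈ Finset.range (p + 1), (feketePolynomial p).coeff (p - i) * (-1) ^ (p - i) := by
    rw [← Finset.sum_range_reflect (fun i => (feketePolynomial p).coeff i * (-1) ^ i) (p + 1)]
    refine Finset.sum_congr rfl fun i _ => ?_
    simp only [add_tsub_cancel_right]
  have hterm : ∀ i ∈ Finset.range (p + 1),
      (feketePolynomial p).coeff (p - i) * (-1 : ℤ) ^ (p - i)
        = -((feketePolynomial p).coeff i * (-1) ^ i) := by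
    intro i hi
    have hi' : i ≤ p := Nat.lt_succ_iff.mp (Finset.mem_range.mp hi)
    have hpow : (-1 : ℤ) ^ (p - i) = -(-1) ^ i := by
      have h1 : (-1 : ℤ) ^ (p - i) * (-1) ^ i = -1 := by
        rw [← pow_add, Nat.sub_add_cancel hi', hodd.neg_one_pow]
      have h2 : ((-1 : ℤ) ^ i) * (-1) ^ i = 1 := by
        rw [← mul_pow, neg_one_mul, neg_neg, one_pow]
      calc (-1 : ℤ) ^ (p - i) = (-1 : ℤ) ^ (p - i) * (-1) ^ i * (-1) ^ i := by
            rw [mul_assoc, h2, mul_one]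
        _ = -(-1) ^ i := by rw [h1, neg_one_mul]
    rw [coeff_feketePolynomial_rev, hneg1, one_mul, hpow, mul_neg]
  have hsum : ∑ i ∈ Finset.range (p + 1), (feketePolynomial p).coeff i * (-1 : ℤ) ^ i
      = -∑ i ∈ Finset.range (p + 1), (feketePolynomial p).coeff i * (-1 : ℤ) ^ i := by
    conv_lhs => rw [hrefl, Finset.sum_congr rfl hterm, Finset.sum_neg_distrib]
  rw [hS]
  linarith

end Literature.NumberTheory.LFunctions
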